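import Literature.Topology.FourManifolds.HomotopyBallSliceProofs
import Literature.Topology.FourManifolds.CerfGammaFourProofs
import Literature.Topology.FourManifolds.KnotFraming
import Summits.SmoothPoincare4.SmoothPoincare4.Theses.DottedCircleRasmussen
import Summits.SmoothPoincare4.SmoothPoincare4.Theses.ZeroSurgeryExotic

/-!
# Crux `DcrGap` (stmt-SmoothPoincare4-16128), line `Sketch` — stub `stub_depthZeroImport`

The **depth-0 door** of the line (card `filling-disc-depth` §(1), "depth 0 = FGMW"): the waypoint
`ZseHsliceNotSlice` of route `ZeroSurgeryExotic` (item stmt-SmoothPoincare4-0520) — an `S³`-knot `K`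
slice in a homotopy 4-ball (`Knot.IsHomotopyBallSlice`) but not in `B⁴` — IS a one-handle slice gap
with NO dotted circle (`k = 0`), i.e. it implies the route target `DottedCircleRasmussen.DcrGap`.
The model handlebody `D_0 = {|z|²/40² + |w|² ≤ 1}` is the image of the closed unit ball under the
linear stretch `A(z, w) = (40 z, w)`; the model knot is `A ∘ K ⊂ ∂D_0`, the complement-slice datum in
the homotopy sphere `Σ` is `(e ∘ A⁻¹, f)` for the homotopy-ball datum `(e, f)`, and a datum `(e', f')`
in any `N ≅ S⁴` pulls back to `K.IsSliceDiscIn N (e' ∘ A) f'`, which makes `K` smoothly slice by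
Palais' ball-complement theorem (the tree's `Knot.palais_ballComplement_sphere_four_holds`,
`Knot.IsSliceDiscIn.exists_isProperDisc`, `Knot.isSmoothlySlice_of_isProperDisc_holds`) — contradiction.
No definitions, no named facts, no `sorry`.

References: Freedman–Gompf–Morrison–Walker, Quantum Topol. 1 (2010), §1
[FreedmanGompfMorrisonWalker2010]; Palais, Proc. AMS 11 (1960), Thm. B [Palais1960].
-/

noncomputable section

set_option linter.dupNamespace false

open scoped Manifold ContDiff Topology
open Function Set
open Literature.Topology.FourManifolds

namespace Summit.SmoothPoincare4.SmoothPoincare4.Theorems.DcrGap.Sketch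

/-! ### The stretch `A(z, w) = (40 z, w)` carrying the unit ball onto `D_0` -/

/-- **The stretch** `A(x₀, x₁, x₂, x₃) = (40 x₀, 40 x₁, x₂, x₃)` exists as a continuous linear
automorphism of `ℝ⁴` (stated existentially, with its four coordinate identities). [folklore] -/
theorem depthZero_exists_stretch :
    ∃ A : EuclideanSpace ℝ (Fin 4) ≃L[ℝ] EuclideanSpace ℝ (Fin 4),
      (∀ x, A x 0 = 40 * x 0) ∧ (∀ x, A x 1 = 40 * x 1) ∧ (∀ x, A x 2 = x 2) ∧ ∀ x, A x 3 = x 3 := by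
  refine ⟨LinearEquiv.toContinuousLinearEquiv
    { toFun := fun x => !₂[40 * x 0, 40 * x 1, x 2, x 3]
      map_add' := fun x y ↦ by ext i; fin_cases i <;> simp [mul_add]
      map_smul' := fun c x ↦ by ext i; fin_cases i <;> simp <;> ring
      invFun := fun x => !₂[x 0 / 40, x 1 / 40, x 2, x 3]
      left_inv := fun x ↦ by ext i; fin_cases i <;> simp
      right_inv := fun x ↦ by ext i; fin_cases i <;> simp <;> ring },
    fun x => ?_, fun x => ?_, fun x => ?_, fun x => ?_⟩ <;> rfl

section Stretch

variable {A : EuclideanSpace ℝ (Fin 4) ≃L[ℝ] EuclideanSpace ℝ (Fin 4)}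
  (h0 : ∀ x, A x 0 = 40 * x 0) (h1 : ∀ x, A x 1 = 40 * x 1) (h2 : ∀ x, A x 2 = x 2)
  (h3 : ∀ x, A x 3 = x 3)
include h0 h1 h2 h3

/-- `A v` lies in the literal model handlebody `D_0` of the route (no holes:
`{(x₀²+x₁²)/(40·1)² + 0 + x₂² + x₃² ≤ 1}`) iff `v` lies in the closed unit ball. [folklore] -/
theorem depthZero_stretch_mem_model_iff (v : EuclideanSpace ℝ (Fin 4)) :
    A v ∈ {x : EuclideanSpace ℝ (Fin 4) | (∀ j : Fin 0, (1 : ℝ) ≤ (x 0 - 4 * (((j : ℕ) : ℝ) + 1)) ^ 2 + (x 1) ^ 2) ∧ ((x 0) ^ 2 + (x 1) ^ 2) / (40 * ((((0 : ℕ) : ℕ) : ℝ) + 1)) ^ 2 + (∑ j : Fin 0, 1 / ((x 0 - 4 * (((j : ℕ) : ℝ) + 1)) ^ 2 + (x 1) ^ 2)) + (x 2) ^ 2 + (x 3) ^ 2 ≤ 1} ↔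
      v ∈ Metric.closedBall (0 : EuclideanSpace ℝ (Fin 4)) 1 := by
  rw [Metric.mem_closedBall, dist_zero_right, ← sq_le_one_iff₀ (norm_nonneg _),
    EuclideanSpace.norm_sq_eq]
  simp only [mem_setOf_eq, IsEmpty.forall_iff, true_and, Finset.univ_eq_empty, Finset.sum_empty,
    add_zero, Real.norm_eq_abs, sq_abs, Fin.sum_univ_four, h0, h1, h2, h3, CharP.cast_eq_zero,
    zero_add, mul_one]
  constructor <;> intro h <;> nlinarith [h]

/-- `A` carries the closed unit ball onto the literal `D_0`: `A '' 𝔻⁴ = D_0`. [folklore] -/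
theorem depthZero_image_stretch_closedBall :
    A '' Metric.closedBall (0 : EuclideanSpace ℝ (Fin 4)) 1 =
      {x : EuclideanSpace ℝ (Fin 4) | (∀ j : Fin 0, (1 : ℝ) ≤ (x 0 - 4 * (((j : ℕ) : ℝ) + 1)) ^ 2 + (x 1) ^ 2) ∧ ((x 0) ^ 2 + (x 1) ^ 2) / (40 * ((((0 : ℕ) : ℕ) : ℝ) + 1)) ^ 2 + (∑ j : Fin 0, 1 / ((x 0 - 4 * (((j : ℕ) : ℝ) + 1)) ^ 2 + (x 1) ^ 2)) + (x 2) ^ 2 + (x 3) ^ 2 ≤ 1} := by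
  ext y
  constructor
  · rintro ⟨v, hv, rfl⟩
    exact (depthZero_stretch_mem_model_iff h0 h1 h2 h3 v).2 hv
  · intro hy
    refine ⟨A.symm y, ?_, A.apply_symm_apply y⟩
    rw [← depthZero_stretch_mem_model_iff h0 h1 h2 h3, A.apply_symm_apply]
    exact hy

/-- `A⁻¹` carries the literal `D_0` onto the closed unit ball: `A⁻¹ '' D_0 = 𝔻⁴`. [folklore] -/
theorem depthZero_image_symm_model :
    A.symm '' {x : EuclideanSpace ℝ (Fin 4) | (∀ j : Fin 0, (1 : ℝ) ≤ (x 0 - 4 * (((j : ℕ) : ℝ) + 1)) ^ 2 + (x 1) ^ 2) ∧ ((x 0) ^ 2 + (x 1) ^ 2) / (40 * ((((0 : ℕ) : ℕ) : ℝ) + 1)) ^ 2 + (∑ j : Fin 0, 1 / ((x 0 - 4 * (((j : ℕ) : ℝ) + 1)) ^ 2 + (x 1) ^ 2)) + (x 2) ^ 2 + (x 3) ^ 2 ≤ 1} =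
      Metric.closedBall (0 : EuclideanSpace ℝ (Fin 4)) 1 := by
  ext v
  constructor
  · rintro ⟨y, hy, rfl⟩
    rw [← depthZero_stretch_mem_model_iff h0 h1 h2 h3, A.apply_symm_apply]
    exact hy
  · intro hv
    exact ⟨A v, (depthZero_stretch_mem_model_iff h0 h1 h2 h3 v).2 hv, A.symm_apply_apply v⟩

/-! ### The model knot `A ∘ K` on `∂D_0` -/

/-- **The stretched knot is a model knot in `∂D_0`**: for a knot `K : S¹ ↪ S³`, the loop
`t ↦ A (K t)` is `C^∞`, injective, immersive, and lies on the ellipsoid `{G_0 = 1}` — the literal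
binder block of `DcrGap` with `k = 0`. [folklore] -/
theorem depthZero_modelKnot (K : Knot) :
    ContMDiff (𝓡 1) 𝓘(ℝ, EuclideanSpace ℝ (Fin 4)) ((⊤ : ℕ∞) : WithTop ℕ∞) (fun t => A ((K t : Metric.sphere (0 : EuclideanSpace ℝ (Fin 4)) 1) : EuclideanSpace ℝ (Fin 4))) ∧ Function.Injective (fun t => A ((K t : Metric.sphere (0 : EuclideanSpace ℝ (Fin 4)) 1) : EuclideanSpace ℝ (Fin 4))) ∧ (∀ t, Function.Injective (mfderiv (𝓡 1) 𝓘(ℝ, EuclideanSpace ℝ (Fin 4)) (fun t => A ((K t : Metric.sphere (0 : EuclideanSpace ℝ (Fin 4)) 1) : EuclideanSpace ℝ (Fin 4))) t)) ∧ ∀ t, ((∀ j : Fin 0, (1 : ℝ) ≤ ((fun t => A ((K t : Metric.sphere (0 : EuclideanSpace ℝ (Fin 4)) 1) : EuclideanSpace ℝ (Fin 4))) t 0 - 4 * (((j : ℕ) : ℝ) + 1)) ^ 2 + ((fun t => A ((K t : Metric.sphere (0 : EuclideanSpace ℝ (Fin 4)) 1) : EuclideanSpace ℝ (Fin 4)))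 t 1) ^ 2) ∧ (((fun t => A ((K t : Metric.sphere (0 : EuclideanSpace ℝ (Fin 4)) 1) : EuclideanSpace ℝ (Fin 4))) t 0) ^ 2 + ((fun t => A ((K t : Metric.sphere (0 : EuclideanSpace ℝ (Fin 4)) 1) : EuclideanSpace ℝ (Fin 4))) t 1) ^ 2) / (40 * ((((0 : ℕ) : ℕ) : ℝ) + 1)) ^ 2 + (∑ j : Fin 0, 1 / (((fun t => A ((K t : Metric.sphere (0 : EuclideanSpace ℝ (Fin 4)) 1) : EuclideanSpace ℝ (Fin 4))) t 0 - 4 * (((j : ℕ) : ℝ) + 1)) ^ 2 + ((fun t => A ((K t : Metric.sphere (0 : EuclideanSpace ℝ (Fin 4)) 1) : EuclideanSpace ℝ (Fin 4))) t 1) ^ 2)) + ((fun t => A ((K t : Metric.sphere (0 : EuclideanSpace ℝ (Fin 4)) 1) : EuclideanSpace ℝ (Fin 4))) t 2) ^ 2 + ((fun t => A ((K t : Metric.sphere (0 : EuclideanSpace ℝ (Fin 4)) 1) : EuclideanSpace ℝ (Fin 4))) t 3) ^ 2 = 1) := by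
  haveI : Fact (Module.finrank ℝ (EuclideanSpace ℝ (Fin 4)) = 3 + 1) := ⟨finrank_euclideanSpace_fin⟩
  have hn : ((⊤ : ℕ∞) : WithTop ℕ∞) ≠ 0 := by simp
  -- the knot as a map into `ℝ⁴`
  set κ : (Metric.sphere (0 : EuclideanSpace ℝ (Fin 2)) 1) → EuclideanSpace ℝ (Fin 4) :=
    fun t => ((K t : Metric.sphere (0 : EuclideanSpace ℝ (Fin 4)) 1) : EuclideanSpace ℝ (Fin 4)) with hκ
  have hκs : ContMDiff (𝓡 1) 𝓘(ℝ, EuclideanSpace ℝ (Fin 4)) ((⊤ : ℕ∞) : WithTop ℕ∞) κ :=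
    (contMDiff_coe_sphere (E := EuclideanSpace ℝ (Fin 4)) (n := 3)).comp K.contMDiff
  have hκi : Injective κ := Subtype.val_injective.comp K.injective
  have hκd : ∀ t, Injective (mfderiv (𝓡 1) 𝓘(ℝ, EuclideanSpace ℝ (Fin 4)) κ t) := fun t => by
    have hd1 : MDifferentiableAt (𝓡 1) (𝓡 3) K t := (K.contMDiff t).mdifferentiableAt hn
    have hd2 : MDifferentiableAt (𝓡 3) 𝓘(ℝ, EuclideanSpace ℝ (Fin 4))
        (Subtype.val : (Metric.sphere (0 : EuclideanSpace ℝ (Fin 4)) 1) → EuclideanSpace ℝ (Fin 4))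
        (K t) :=
      ((contMDiff_coe_sphere (E := EuclideanSpace ℝ (Fin 4)) (n := 3)) (K t)).mdifferentiableAt hn
    rw [hκ, show (fun t => ((K t : Metric.sphere (0 : EuclideanSpace ℝ (Fin 4)) 1) :
        EuclideanSpace ℝ (Fin 4))) = Subtype.val ∘ K from rfl, mfderiv_comp t hd2 hd1]
    exact (mfderiv_coe_sphere_injective (E := EuclideanSpace ℝ (Fin 4)) (n := 3) (K t)).comp
      (Manifold.IsImmersionAt.mfderiv_injective (K.isSmoothEmbedding.isImmersion.isImmersionAt t) hn)
  have hA : ContMDiff 𝓘(ℝ, EuclideanSpace ℝ (Fin 4)) 𝓘(ℝ, EuclideanSpace ℝ (Fin 4))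
      ((⊤ : ℕ∞) : WithTop ℕ∞) A :=
    (A : EuclideanSpace ℝ (Fin 4) →L[ℝ] EuclideanSpace ℝ (Fin 4)).contDiff.contMDiff
  have hK₀ : (fun t => A ((K t : Metric.sphere (0 : EuclideanSpace ℝ (Fin 4)) 1) :
      EuclideanSpace ℝ (Fin 4))) = A ∘ κ := rfl
  rw [hK₀]
  refine ⟨hA.comp hκs, A.injective.comp hκi, fun t => ?_, fun t => ?_⟩
  · have hd1 : MDifferentiableAt (𝓡 1) 𝓘(ℝ, EuclideanSpace ℝ (Fin 4)) κ t :=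
      (hκs t).mdifferentiableAt hn
    have hd2 : MDifferentiableAt 𝓘(ℝ, EuclideanSpace ℝ (Fin 4)) 𝓘(ℝ, EuclideanSpace ℝ (Fin 4))
        A (κ t) := (hA (κ t)).mdifferentiableAt hn
    have hmA : mfderiv 𝓘(ℝ, EuclideanSpace ℝ (Fin 4)) 𝓘(ℝ, EuclideanSpace ℝ (Fin 4)) A (κ t) =
        (A : EuclideanSpace ℝ (Fin 4) →L[ℝ] EuclideanSpace ℝ (Fin 4)) := by
      rw [mfderiv_eq_fderiv]; exact A.fderiv
    rw [mfderiv_comp t hd2 hd1, hmA]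
    exact A.injective.comp (hκd t)
  · have hmem : ‖κ t‖ = 1 := by simp [hκ]
    have hsq : ‖κ t‖ ^ 2 = 1 := by rw [hmem, one_pow]
    rw [EuclideanSpace.norm_sq_eq] at hsq
    simp only [Real.norm_eq_abs, sq_abs, Fin.sum_univ_four] at hsq
    refine ⟨fun j => j.elim0, ?_⟩
    simp only [comp_apply, Finset.univ_eq_empty, Finset.sum_empty, add_zero, CharP.cast_eq_zero,
      zero_add, mul_one, h0, h1, h2, h3]
    nlinarith [hsq]

end Stretch

/-! ### The stub -/

/-- **Stub `stub_depthZeroImport` (depth-0 door of line `Sketch`)**: an `S³`-knot slice in a homotopy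
4-ball but not in `B⁴` gives the one-handle slice gap with `k = 0` — witness `A ∘ K ⊂ ∂D_0`, datum
`(e ∘ A⁻¹, f)` in the same homotopy sphere; a datum in some `N ≅ S⁴` would pull back along `A` to
`K.IsSliceDiscIn N (e' ∘ A) f'` and make `K` smoothly slice (Palais' ball-complement theorem).
[cite: FreedmanGompfMorrisonWalker2010, §1] [cite: Palais1960, Thm. B] -/
theorem stub_depthZeroImport : Summit.SmoothPoincare4.SmoothPoincare4.Theses.ZeroSurgeryExotic.ZseHsliceNotSlice → Summit.SmoothPoincare4.SmoothPoincare4.Theses.DottedCircleRasmussen.DcrGap := by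
  rintro ⟨K, ⟨M, i1, i2, i3, i4, i5, i6, hM, e, f, hef⟩, hns⟩
  obtain ⟨A, hA0, hA1, hA2, hA3⟩ := depthZero_exists_stretch
  obtain ⟨he, hf, hinj, hmf, hout, hbdry⟩ := hef
  obtain ⟨hK1, hK2, hK3, hK4⟩ := depthZero_modelKnot hA0 hA1 hA2 hA3 K
  refine ⟨0, fun t => A ((K t : Metric.sphere (0 : EuclideanSpace ℝ (Fin 4)) 1) :
      EuclideanSpace ℝ (Fin 4)), ⟨hK1, hK2, hK3, hK4⟩, ⟨M, i1, i2, i3, i4, i5, hM,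
      e ∘ A.symm, f, ?_, hf, hinj, hmf, ?_, ?_⟩, ?_⟩
  · -- `e ∘ A⁻¹` is a smooth embedding
    have : e ∘ A.symm = e ∘ A.symm.toDiffeomorph := by ext x; simp
    rw [this]
    exact he.comp_diffeomorph A.symm.toDiffeomorph
  · -- properness: the open disc misses `(e ∘ A⁻¹)(D_0) = e(𝔻⁴)`
    intro x hx hmem
    rw [Set.image_comp, depthZero_image_symm_model hA0 hA1 hA2 hA3] at hmem
    exact hout x hx hmem
  · -- boundary: `f = (e ∘ A⁻¹) ∘ (A ∘ K)` on `S¹`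
    intro t
    simp only [comp_apply, ContinuousLinearEquiv.symm_apply_apply]
    exact hbdry t
  · -- no-disc clause: a datum in `N ≅ S⁴` makes `K` smoothly slice
    intro N _ _ _ _ _ hN e' f' h'
    obtain ⟨Φ⟩ := hN
    obtain ⟨he', hf', hinj', hmf', hout', hbdry'⟩ := h'
    have hslice : K.IsSliceDiscIn N (e' ∘ A) f' := by
      refine ⟨?_, hf', hinj', hmf', fun x hx hmem => ?_, fun t => hbdry' t⟩
      · have : e' ∘ A = e' ∘ A.toDiffeomorph := by ext x; simp
        rw [this]
        exact he'.comp_diffeomorph A.toDiffeomorph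
      · rw [Set.image_comp, depthZero_image_stretch_closedBall hA0 hA1 hA2 hA3] at hmem
        exact hout' x hx hmem
    apply hns
    have h'' := hslice.diffeomorph_comp Φ
    obtain ⟨U, c, hc₁, hc₂⟩ :=
      Knot.palais_ballComplement_sphere_four_holds (Φ ∘ (e' ∘ A)) h''.isSmoothEmbedding
    obtain ⟨g, hg⟩ := h''.exists_isProperDisc c hc₁ hc₂
    exact Knot.isSmoothlySlice_of_isProperDisc_holds K g hg

end Summit.SmoothPoincare4.SmoothPoincare4.Theorems.DcrGap.Sketch

end
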